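import Summits.HubbardSuperconductivity.HubbardSuperconductivity.Theorems.AnisotropyChordTransferFibre3FinX3Eval
import Summits.HubbardSuperconductivity.HubbardSuperconductivity.Theorems.AnisotropyChordTransferFibre3FinX5P38q061
import Summits.HubbardSuperconductivity.HubbardSuperconductivity.Theorems.AnisotropyChordTransferFibre3FinX5P38q062

/-!
# Route `AnisotropyChord` / H0 rotor rung: FIN per-`L` GM₃ (X5), `L = 38` — rows `N₁` / D / side-condition cell facts, part `p61`

Kernel facts (`decide +kernel`) for cert cells 81 of the per-`L` grid of `L = 38`: `xbnCellAny2` (row `N₁` on XB2 point wedges recomputed in the kernel, exporting the literal brackets `nt ⊇ T⁺ − 3λ₂` and `tb ⊇ T⁺·D`), `xdCellAnyN0` (row D, reads `nt`), `sdCellAnyZN` (side condition, reads `nt`); evaluators `…FinX3Eval` / `…FinX5Eval`; constants from the compiled design probe (x3probe/x3plan, margins c ×0.985, b ×1.03, aD ×1.03); assembled in `…FinX5GM3ThirtyEight`.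
Prover seat `hubbard-h0-rotor-p3` g9; helper for piece A = stmt-HubbardSuperconductivity-23918 of rung 19089 (`--supports`, helper class).
WHAT THIS IS NOT: nothing here proves superconductivity in the Hubbard model (rotor TARGET as worded stays FALSE, g15 verdict); kernel facts for the FIN certificate of ONE conditional reduction.  Tree imports only; zero data; standard axioms.
-/

set_option linter.dupNamespace false
set_option autoImplicit false

namespace Summit.HubbardSuperconductivity.HubbardSuperconductivity.Theorems.AnisotropyChord.Transfer.Fibre3

namespace FinXD

open FinXB FinCell Hole2

set_option maxHeartbeats 4000000 in
/-- row `N₁` of cell 81 of `L = 38` (`c = 59/100`), exporting `nt`, `tb`. [folklore] -/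
theorem xn38_81 : xbnCellAny2 38 (49/50 : ℚ) 500884681779074 518916530323121 (59/100 : ℚ) ((3078176867922 : ℤ), (5531492632703 : ℤ)) ((1505719015284823 : ℤ), (1562294290522387 : ℤ)) = true := by
  unfold xbnCellAny2
  rw [twp38_61_eq, twp38_62_eq]
  decide +kernel

set_option maxHeartbeats 4000000 in
/-- row D of cell 81 of `L = 38` (`aD = 27/250`). [folklore] -/
theorem xd38_81 : xdCellAnyN0 38 (49/50 : ℚ) 500884681779074 518916530323121 (27/250 : ℚ) ((3078176867922 : ℤ), (5531492632703 : ℤ)) = true := by decide +kernel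

set_option maxHeartbeats 4000000 in
/-- side condition of cell 81 of `L = 38` (`c, b = 86/100, aD`). [folklore] -/
theorem sd38_81 : sdCellAnyZN 38 (49/50 : ℚ) 100 500884681779074 518916530323121 ((59/100 : ℚ), (86 : ℕ), (27/250 : ℚ)) ((3078176867922 : ℤ), (5531492632703 : ℤ)) = true := by decide +kernel

end FinXD

end Summit.HubbardSuperconductivity.HubbardSuperconductivity.Theorems.AnisotropyChord.Transfer.Fibre3
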